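import Summits.BirchSwinnertonDyer.BirchSwinnertonDyer.Theorems.ResidualThetaTransportAtTwoSignedMuVanishingAtTwoPlusCuspSpanLevelLowering
import Summits.BirchSwinnertonDyer.BirchSwinnertonDyer.Theorems.ResidualThetaTransportAtTwoSignedMuVanishingAtTwoPlusCuspSpanGamma1
import HarnessLib

/-!
# Route `ResidualThetaTransportAtTwo`, crux Kμ⁺ `SignedMuVanishingAtTwoPlus` (stmt-BirchSwinnertonDyer-20689), line `birth`,
# node item 27436 `CuspSpanEvenAtTwoOdd`: **THE MERSENNE REDUCTION** — the node at EVERY odd level follows from the trace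
# form (G″) along the single divisibility chain of levels `4^n − 1`

Cell `bsd-wall`, width seat `bsd-wall-rtt-p4-w2` (g6). THEOREMS ONLY (no `def`, no named fact, no `sorry`); helper
`--supports` the crux; closes nothing. BSD is not proved by this; the chain hypothesis below is OPEN (it is the node itself,
restricted to the levels `4^n − 1`).

THEOREM (`cuspSpanEvenAtTwo_of_mersenne`; the route-item form `cuspSpanEvenAtTwoOdd_of_mersenne` and the closers of line `birth`
are in the sequel `…CuspSpanMersenneClosers`, which alone imports the route file). Suppose that for every `n ≥ B` the TRACE form
(G″) holds at the level `M_n := 4^n − 1` (every additive `χ : Γ₀(M_n) → ZMod 2` killing the elements of trace `0, ±1, ±2` and the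
elements whose lower-right entry is `±4^k`, `k ≥ 1`, is `ψ ∘ d` with `ψ` multiplicative on units) — equivalently
(`…_of_mersenne_gamma1`) `Γ₁'(4^n − 1) ≤ M_{4^n − 1}` := the subgroup of `Γ₀(4^n − 1)` generated by the small-trace elements, the
`4^k`-elements, the squares and the commutators. Then `CuspSpanEvenAtTwo N` holds for EVERY odd `N`, i.e. the route item 27436
`CuspSpanEvenAtTwoOdd` holds; hence (by the landed closers of line `birth`, BY NAME) the registered stub `FlatMuZeroAtTwo`, the
analytic child 21437 modulo Abbes–Ullmo / the PUB⁵ item 27435, and the crux Kμ⁺ modulo {seed 21438, 27435}.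

PROOF. `N` odd ⟹ `gcd(4, N) = 1` ⟹ `4^φ(N) ≡ 1 (mod N)` (Euler, `Nat.ModEq.pow_totient`) ⟹ `N ∣ 4^n − 1` for
`n := φ(N)·(B+1) ≥ B` (`4^φ − 1 ∣ 4^{φ(B+1)} − 1`, `Nat.pow_sub_one_dvd_pow_sub_one`); then w2 g5's LEVEL LOWERING
`cuspSpanEvenAtTwo_of_cuspSpanTrace_of_dvd` (p626294: the set of levels where (G″) holds is closed under divisors) transports (G″)
from `4^n − 1` down to `N`. Nothing else.

WHAT THIS SAYS (numbers, not adjectives). The class-wide research residue «(G′)_N for every odd N» of 27436 / 21437 / Kan⁺ 20688 /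
TP2 K1 is EQUIVALENT in strength to its restriction to ONE chain of levels `3 ∣ 15 ∣ … ∣ 4^n − 1 ∣ 4^{2n} − 1 ∣ …` (conversely every
`4^n − 1` is odd), and even to any divisibility-cofinal sub-chain (all `n ≥ B`; `n = m!`; …). These are exactly the levels where
`⟨4⟩ ⊂ (ℤ/M)ˣ` is SMALLEST for the size of the level (`ord_{4^n−1}(4) = n`), the regime where lead g6's `FourPowGeneration.md` §2/§5
located all the depth (the two levels where coset enumeration of Conjecture A stalled were `255 = 4⁴ − 1` and `257 ∣ 4⁸ − 1`). So
the cheapest falsifier of the node is the homology check of (G″) at `4095 = 4⁶ − 1`, `16383 = 4⁷ − 1`, `65535 = 4⁸ − 1`, … — the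
first members of the chain beyond the range `N ≤ 2999` verified by lead g4/g5 (levels `3, 15, 63, 255, 1023` are inside it).

References: G. Shimura, *Introduction to the arithmetic theory of automorphic functions* (1971) Prop. 1.43 [ShimuraIATAF1971];
A. W. Knapp, *Elliptic curves* (1992) Prop. 11.22 [Knapp1993]; R. Pollack, Duke Math. J. 118 (2003) Conj. 6.3 [Pollack2003].
-/

set_option autoImplicit false
-- justification: the `Summit.BirchSwinnertonDyer.BirchSwinnertonDyer.…` path repeats a component (route-file convention)
set_option linter.dupNamespace false

noncomputable section

open scoped MatrixGroups

open CongruenceSubgroup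

namespace Summit.BirchSwinnertonDyer.BirchSwinnertonDyer.Theorems.SignedMuAtTwo

/-! ## §1. Arithmetic of the chain `4^n − 1` -/

section Chain

/-- `4^n − 1 ≠ 0` for `n ≥ 1`. [folklore] -/
theorem four_pow_sub_one_ne_zero {n : ℕ} (hn : 1 ≤ n) : 4 ^ n - 1 ≠ 0 := by
  have h : 4 ≤ 4 ^ n := by
    calc (4 : ℕ) = 4 ^ 1 := by norm_num
      _ ≤ 4 ^ n := Nat.pow_le_pow_right (by norm_num) hn
  omega

/-- `4^n − 1` is odd for `n ≥ 1` (so every member of the chain is itself an odd level). [folklore] -/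
theorem not_two_dvd_four_pow_sub_one {n : ℕ} (hn : 1 ≤ n) : ¬ 2 ∣ 4 ^ n - 1 := by
  have h1 : 1 ≤ 4 ^ n := Nat.one_le_pow _ _ (by norm_num)
  have h2 : 2 ∣ 4 ^ n := by
    obtain ⟨m, rfl⟩ := Nat.exists_eq_add_of_le hn
    rw [pow_add, pow_one]
    exact Dvd.dvd.mul_right (by norm_num : (2 : ℕ) ∣ 4) _
  omega

/-- The chain is a divisibility chain: `m ∣ n ⟹ 4^m − 1 ∣ 4^n − 1`. [folklore] -/
theorem four_pow_sub_one_dvd_of_dvd {m n : ℕ} (h : m ∣ n) : 4 ^ m - 1 ∣ 4 ^ n - 1 :=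
  Nat.pow_sub_one_dvd_pow_sub_one 4 h

/-- **Every odd `N` divides a member of the chain beyond any bound**: for `2 ∤ N` and every `B` there is `n ≥ B`, `n ≥ 1`, with
`N ∣ 4^n − 1` (Euler: `4^φ(N) ≡ 1 (mod N)`, and `4^φ − 1 ∣ 4^{φ(B+1)} − 1`). [folklore] -/
theorem exists_dvd_four_pow_sub_one {N : ℕ} (hN0 : N ≠ 0) (hN : ¬ 2 ∣ N) (B : ℕ) :
    ∃ n : ℕ, B ≤ n ∧ 1 ≤ n ∧ N ∣ 4 ^ n - 1 := by
  have hcop : Nat.Coprime 4 N := by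
    have h2 : Nat.Coprime 2 N := (Nat.Prime.coprime_iff_not_dvd Nat.prime_two).mpr hN
    have : Nat.Coprime (2 ^ 2) N := Nat.Coprime.pow_left 2 h2
    simpa using this
  have hE : 4 ^ N.totient ≡ 1 [MOD N] := Nat.ModEq.pow_totient hcop
  have hφ : 1 ≤ N.totient := Nat.totient_pos.mpr (Nat.pos_of_ne_zero hN0)
  have hdvd : N ∣ 4 ^ N.totient - 1 :=
    (Nat.modEq_iff_dvd' (Nat.one_le_pow _ _ (by norm_num))).mp hE.symm
  refine ⟨N.totient * (B + 1), ?_, ?_, hdvd.trans (four_pow_sub_one_dvd_of_dvd (dvd_mul_right _ _))⟩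
  · calc B ≤ B + 1 := Nat.le_succ B
      _ = 1 * (B + 1) := (one_mul _).symm
      _ ≤ N.totient * (B + 1) := Nat.mul_le_mul_right _ hφ
  · exact le_trans hφ (Nat.le_mul_of_pos_right _ (Nat.succ_pos B))

end Chain

/-! ## §2. The Mersenne reduction of the node -/

section Node

/-- **MERSENNE REDUCTION (trace form).** If the trace form (G″) holds at the level `4^n − 1` for every `n ≥ B`, then the named
node `CuspSpanEvenAtTwo N` holds at EVERY odd level `N`: `N ∣ 4^n − 1` for some `n ≥ B` (`exists_dvd_four_pow_sub_one`) and the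
trace form descends to divisors (`cuspSpanEvenAtTwo_of_cuspSpanTrace_of_dvd`, w2 g5). The hypothesis is OPEN (it is the node
on the chain); nothing is asserted. [cite: ShimuraIATAF1971, Prop. 1.43] [cite: Pollack2003, Conj. 6.3] -/
theorem cuspSpanEvenAtTwo_of_mersenne (B : ℕ)
    (hG : ∀ n : ℕ, B ≤ n → ∀ χ : Gamma0 (4 ^ n - 1) → ZMod 2,
      (∀ γ δ : Gamma0 (4 ^ n - 1), χ (γ * δ) = χ γ + χ δ) →
      (∀ γ : Gamma0 (4 ^ n - 1), ((γ : SL(2, ℤ)) 0 0 + (γ : SL(2, ℤ)) 1 1).natAbs ≤ 2 → χ γ = 0) →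
      (∀ γ : Gamma0 (4 ^ n - 1), (∃ k : ℕ, 1 ≤ k ∧ ((γ : SL(2, ℤ)) 1 1).natAbs = 4 ^ k) → χ γ = 0) →
      ∃ ψ : ZMod (4 ^ n - 1) → ZMod 2, (∀ x y : ZMod (4 ^ n - 1), IsUnit x → IsUnit y → ψ (x * y) = ψ x + ψ y) ∧
        ∀ γ : Gamma0 (4 ^ n - 1), χ γ = ψ ((((γ : SL(2, ℤ)) 1 1 : ℤ) : ZMod (4 ^ n - 1))))
    (N : ℕ) [NeZero N] (hN : ¬ 2 ∣ N) : CuspSpanEvenAtTwo N := by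
  obtain ⟨n, hBn, hn1, hdvd⟩ := exists_dvd_four_pow_sub_one (NeZero.ne N) hN B
  exact cuspSpanEvenAtTwo_of_cuspSpanTrace_of_dvd (four_pow_sub_one_ne_zero hn1) hdvd (hG n hBn)

/-- **MERSENNE REDUCTION (membership form).** If `Γ₁'(4^n − 1) ≤ M_{4^n − 1}` for every `n ≥ B` — every element of
`Γ₀(4^n − 1)` with lower-right entry `≡ 1 (mod 4^n − 1)` is a product of elements of trace `0, ±1, ±2`, elements with
lower-right entry `±4^k` (`k ≥ 1`), squares and commutators — then `CuspSpanEvenAtTwo N` holds at every odd level `N`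
(rtt-p4-w3's `cuspSpanTrace_iff_gamma1_le_closure` + the trace-form reduction). [cite: Knapp1993, Prop. 11.22] [cite: Pollack2003, Conj. 6.3] -/
theorem cuspSpanEvenAtTwo_of_mersenne_gamma1 (B : ℕ)
    (hM : ∀ n : ℕ, B ≤ n → ∀ [NeZero (4 ^ n - 1)], Gamma1' (4 ^ n - 1) ≤ Subgroup.closure
      ({γ : Gamma0 (4 ^ n - 1) | ((γ : SL(2, ℤ)) 0 0 + (γ : SL(2, ℤ)) 1 1).natAbs ≤ 2} ∪
        {γ : Gamma0 (4 ^ n - 1) | ∃ k : ℕ, 1 ≤ k ∧ ((γ : SL(2, ℤ)) 1 1).natAbs = 4 ^ k} ∪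
        {γ : Gamma0 (4 ^ n - 1) | ∃ g : Gamma0 (4 ^ n - 1), g * g = γ} ∪ commutatorSet (Gamma0 (4 ^ n - 1))))
    (N : ℕ) [NeZero N] (hN : ¬ 2 ∣ N) : CuspSpanEvenAtTwo N := by
  obtain ⟨n, hBn, hn1, hdvd⟩ := exists_dvd_four_pow_sub_one (NeZero.ne N) hN (max B 1)
  haveI : NeZero (4 ^ n - 1) := ⟨four_pow_sub_one_ne_zero hn1⟩
  exact cuspSpanEvenAtTwo_of_cuspSpanTrace_of_dvd (four_pow_sub_one_ne_zero hn1) hdvd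
    (cuspSpanTrace_of_gamma1_le_closure (hM n (le_trans (le_max_left _ _) hBn)))

/-- **Upward poisoning along the chain.** If the trace form FAILS at some level `4^m − 1` then it fails at `4^n − 1` for every
multiple `n ≥ 1` of `m` (contrapositive of this level lowering along `4^m − 1 ∣ 4^n − 1`): a counterexample on the chain is
inherited by all later members it divides. [cite: ShimuraIATAF1971, Prop. 1.43] -/
theorem cuspSpanTrace_four_pow_sub_one_of_dvd {m n : ℕ} (hn : 1 ≤ n) (hmn : m ∣ n)
    (hG : ∀ χ : Gamma0 (4 ^ n - 1) → ZMod 2,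
      (∀ γ δ : Gamma0 (4 ^ n - 1), χ (γ * δ) = χ γ + χ δ) →
      (∀ γ : Gamma0 (4 ^ n - 1), ((γ : SL(2, ℤ)) 0 0 + (γ : SL(2, ℤ)) 1 1).natAbs ≤ 2 → χ γ = 0) →
      (∀ γ : Gamma0 (4 ^ n - 1), (∃ k : ℕ, 1 ≤ k ∧ ((γ : SL(2, ℤ)) 1 1).natAbs = 4 ^ k) → χ γ = 0) →
      ∃ ψ : ZMod (4 ^ n - 1) → ZMod 2, (∀ x y : ZMod (4 ^ n - 1), IsUnit x → IsUnit y → ψ (x * y) = ψ x + ψ y) ∧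
        ∀ γ : Gamma0 (4 ^ n - 1), χ γ = ψ ((((γ : SL(2, ℤ)) 1 1 : ℤ) : ZMod (4 ^ n - 1)))) :
    ∀ χ : Gamma0 (4 ^ m - 1) → ZMod 2,
      (∀ γ δ : Gamma0 (4 ^ m - 1), χ (γ * δ) = χ γ + χ δ) →
      (∀ γ : Gamma0 (4 ^ m - 1), ((γ : SL(2, ℤ)) 0 0 + (γ : SL(2, ℤ)) 1 1).natAbs ≤ 2 → χ γ = 0) →
      (∀ γ : Gamma0 (4 ^ m - 1), (∃ k : ℕ, 1 ≤ k ∧ ((γ : SL(2, ℤ)) 1 1).natAbs = 4 ^ k) → χ γ = 0) →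
      ∃ ψ : ZMod (4 ^ m - 1) → ZMod 2, (∀ x y : ZMod (4 ^ m - 1), IsUnit x → IsUnit y → ψ (x * y) = ψ x + ψ y) ∧
        ∀ γ : Gamma0 (4 ^ m - 1), χ γ = ψ ((((γ : SL(2, ℤ)) 1 1 : ℤ) : ZMod (4 ^ m - 1))) :=
  cuspSpanTrace_of_dvd (four_pow_sub_one_ne_zero hn) (four_pow_sub_one_dvd_of_dvd hmn) hG

end Node

end Summit.BirchSwinnertonDyer.BirchSwinnertonDyer.Theorems.SignedMuAtTwo

end
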